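/-
Copyright: public-domain mathematics; typed transcription for the H21 Literature library (cell pub-balaban, PAPER SUB-CELL B05 gen 6).

# Bałaban, *Propagators and renormalization transformations for lattice gauge theories. I*,
# Commun. Math. Phys. **95** (1984) 17–40 — the averaging-operator identities (1.120), the operator identity
# (1.121) for `K(h)`, and the first-order local bound behind (1.128) for the terms `S*(∂h)Q − Q*S(∂h)` of `K(h)`

[cite: Balaban1984PropagatorsI]  T. Bałaban, Commun. Math. Phys. 95 (1984) 17–40 (= B5 of the series).  Quotations
(read by this seat from the page renders `1984-cmp95-propagators-rt-I-p003-x2.png`, `…-p021-x2.png`, `…-p022-x2.png` as images; journal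
page = PDF page + 16):

p. 19 [PDF 3], (1.11): «(QA)_c = Σ_{x∈B(c₋)} L^{−(d+1)} A([x, x(c)]), δ(B − QA) = Π_{c⊂T_L^{(1)}} δ(B_c − (QA)_c), (1.11)»,
with, p. 19, the two lines after (1.8), «where A(Γ) = Σ_{b⊂Γ} A_b for arbitrary contour Γ, and x(c) denotes a point in the block B(c₊)
obtained by translation of x by the bond c, so if c = ⟨y, y + Le_μ⟩ then x(c) = x + Le_μ.»

p. 37 [PDF 21]: «We will prove that C₀ is a good approximation of G. We will be very sketchy with arguments because
they are almost the same as in [2]. At first we calculate Δ_a hA. We have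
(ΔhA)_μ(x) = h(x)(ΔA_μ)(x) − Σ_{b∈st(x)} (∂h)(b)(∂A_μ)(b) + (Δh)(x)A_μ(x),
(QhA)_μ(y) = Σ_{x∈B^k(y)} η^d (hA_μ)([x, x^{(k)}])
  = h(y)(QA)_μ(y) + Σ_{x∈B^k(y)} η^d Σ_{x₁∈[x,x^{(k)}[} η(∂h)(Γ_{y,x} ∪ [x, x₁])A_μ(x₁) = h(y)(QA)_μ(y) + (S(∂h)A)_μ(y),
⟨A_μ, Q*hω_μ⟩ = ⟨hQA_μ, ω_μ⟩ = ⟨QhA_μ − S(∂h)A_μ, ω_μ⟩ = ⟨A_μ, hQ*ω_μ⟩ − ⟨A_μ, S*(∂h)ω_μ⟩,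
so Q*hω_μ = hQ*ω_μ − S*(∂h)ω_μ, and
Q*QhA_μ = Q*hQA_μ + Q*S(∂h)A_μ = hQ*QA_μ − S*(∂h)QA_μ + Q*S(∂h)A_μ,
(∂P∂*hA)_μ(x) = Σ_{x′,ν} η^d (∂P∂*)_{μν}(x, x′)h(x′)A_ν(x′)
  = h(x)(∂P∂*A)_μ(x) − Σ_{x′,ν} η^d (∂h)(Γ_{x,x′})(∂P∂*)_{μν}(x, x′)A_ν(x′) = h(x)(∂P∂*A)_μ(x) − (P₁(∂h)A)_μ(x). (1.120)
These equalities imply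
Δ_a hA = (Δ − ∂P∂* + aQ*Q)hA = hΔ_aA − [Σ_{b∈st(·)} (∂h)(b)(∂A)(b) − (Δh)A + S*(∂h)QA − Q*S(∂h)A + P₁(∂h)A]
  = hΔ_aA − K(h)A, (1.121)»

p. 38 [PDF 22]: «Next we have to estimate |h_{z₁}K(h_{z₂})A|. The operator K(h) is a simple, shortranged, first order
differential operator, except the term P₁(∂h_z). Let us write bounds for the operator ∂P∂*. They follow from the
representation P = G′Q′*(Q′G′²Q′*)⁻¹Q′G′, from Lemma 2.4 of [2], and the representation (1.45) and the analyticity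
method of proving an exponential decay (see the proof of Lemma 2.4 in [2]). We obtain
|(∂P∂*)_{μ,ν}(x, x′)| ≤ O(1)e^{−δ′₀|x−x′|}, (1.126)»; «In the second case we have the small factor O(M₀⁻¹) only, but
we may include the factor exp(−|z′₁ − z′₂|) because |z′₁ − z′₂| ≤ 2d. Defining 2δ₀ = min{⅓δ′₀, M₀⁻¹}, we obtain
|h_{z₁}K(h_{z₂})A| ≤ O(M₀⁻¹)e^{−2δ₀|z₁−z₂|}(|∇A| + |A|). (1.128)»

WHAT THIS MODULE IS.  First module of gen 6 of the b05 kernel chain for Proposition 1.2 (after gen 5's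
`B5TorusCover`, `B5TorusPartition`, `B5Commutator128`, `B5SmoothPartition`, `B5Leibniz121`).  `B5Leibniz121.h128_lap_torus`
proves (1.128) for the model operator `Δ_w + kerOp l′ + kerOp k` and the smooth partition `hS_z`, with TWO hypotheses
left (cell GAPS G-B5-31): (a) a normed commutator bound `ℓ′` for the RESIDUAL LOCAL kernel `l′` — in print the
contributions `S*(∂h)QA − Q*S(∂h)A` of `aQ*Q` (and, if a consumer keeps it finite-range, of `P₁(∂h)`) to `K(h)`; (b) the
decay (1.126) of the kernel `k` of `∂P∂*`.  THIS FILE discharges (a) for every FINITE-RANGE kernel with bounded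
absolute row/column sums — in particular for `aQ*Q` with `Q` any averaging kernel of bounded support and bounded
absolute row/column sums — using ONLY the Lipschitz datum `∇h_z = O(M₀⁻¹)` of the partition (`hSU_lipschitz`): the terms
are FIRST ORDER in `∂h`, as the sentence before (1.126) says.  It also types the objects of (1.120) as kernel operators
between the component spaces of two lattices and kernel-checks the printed identities (1.120) (lines 2–4) and the
operator identity (1.121).

§1 (any two finite index sets `ι` — fine components — and `κ` — coarse components).  RECTANGULAR KERNEL OPERATORS
`rectOp q : ℓ²(ι) →ₗ ℓ²(κ)`, `(rectOp q v)_c = Σ_i q c i · v i` (the shape of `Q` in (1.11)/(1.120): `q(y; x₁, μ) =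
η^{d+1}·#{x ∈ B^k(y) : x₁ ∈ [x, x^{(k)}[}` on `μ`-bonds); composition `rectOp_comp`; square case `rectOp_eq_kerOp`;
the WEIGHTED ADJOINT `rectAdj τ q = rectOp (τ·qᵀ)` (`τ` = the ratio of the weights of the two `ℓ²` pairings, `τ = η^{−d}`
for `⟨·,·⟩_η` against the unit-lattice sum) with its adjunction identity `rectAdj_adjoint`
(`σ·Σ_i v_i (Q*w)_i = Σ_c (Qv)_c w_c` whenever `στ = 1`); the GRAM KERNEL `gram120 τ q i j = Σ_c τ q c i q c j` with
`rectAdj τ q ∘ rectOp q = kerOp (gram120 τ q)` (`rectAdj_comp_rectOp`: `Q*Q` is a square kernel operator on the fine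
components).  THE OBJECTS OF (1.120): `sComm120 q h hc := rectOp (q c i·(h i − hc c))` — `S(∂h)`, the printed double
sum with the contour sum `(∂h)(Γ_{y,x} ∪ [x,x₁]) = h(x₁) − h(y)` telescoped (`hc` = the multiplier on the coarse
components; in print `h(y)`, `y ∈ T₁^{(k)} ⊂ T_η`); `sAdj120 τ q h hc := rectOp (τ·q c i·(h i − hc c))ᵀ` — `S*(∂h)`;
`p1Comm120 k h := kerOp ((h i − h j)·k i j)` — `P₁(∂h)` with `(∂h)(Γ_{x,x′}) = h(x) − h(x′)` (the reading forced by the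
last line of (1.120), cell GAPS G-adv4-21 (i)).  THE IDENTITIES, KERNEL-CHECKED: (1.120) line 2 `Q∘h = h_c∘Q + S(∂h)`
(`rectOp_mulOp`); line 3 `Q*∘h_c = h∘Q* − S*(∂h)` (`rectAdj_mulOp`) and `Q*Q∘h = h∘Q*Q − S*(∂h)Q + Q*S(∂h)`
(`gram_mulOp`); line 4 `∂P∂*∘h = h∘∂P∂* − P₁(∂h)` (`kerOp_mulOp_eq`); and (1.121) AS AN OPERATOR IDENTITY (`K121_eq`):
for `Δ_a := L − kerOp k + a•Q*Q` (`L` any operator standing for `Δ`, whose commutator with `h` is `B5Leibniz121`'s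
Leibniz rule), `hΔ_a − Δ_a h = (hL − Lh) − P₁(∂h) + a(S*(∂h)Q − Q*S(∂h))`.  REMARK (print level, = cell GAPS G-adv4-21
(i)–(ii), now kernel-certified): with the definitions of (1.120) the bracket of (1.121) is
`Σ(∂h)(∂A) − (Δh)A − P₁(∂h)A + aS*(∂h)QA − aQ*S(∂h)A` — the printed `+P₁(∂h)A` has the sign of the opposite contour
orientation and the factor `a` of the two `S`-terms is dropped in print; only `|·|` of these terms is used downstream.
§2 THE FIRST-ORDER LOCAL BOUND (any pseudometric base `π : ι → X`).  `norm_comm_finiteRange_le`: if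
`|a_i − a_j| ≤ ℓ·dist(π i, π j)`, `m_ij = 0` whenever `dist(π i, π j) > ρ`, and the absolute row and column sums of `m`
are `≤ R`, then `‖[mulOp a, kerOp m] v‖ ≤ ℓρR‖v‖` (commutator identity + Schur test: the entries are
`(a_i − a_j)m_ij`, of size `≤ ℓρ|m_ij|`); on the torus with the smooth partition (`ℓ = 4d/M₀`, `hSU_lipschitz`):
`local_finiteRange_HS`, `‖[hS_z, kerOp m]A‖ ≤ (4d/M₀)ρR‖A‖`, and in the shape of the hypothesis `local′` of
`h128_lap_torus` (`local_finiteRange_HS'`).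
§3 SUPPORT AND SCHUR DATA OF `Q*Q` FROM THOSE OF `Q` (coarse base `σ : κ → X`, fine base `π : ι → X`): if
`q c i ≠ 0 ⇒ dist(σ c, π i) ≤ r` then `gram120 τ q i j = 0` for `dist(π i, π j) > 2r` (`gram120_eq_zero_of_far`); if the
absolute column sums of `q` are `≤ C_col` and the absolute row sums `≤ R_row` (`τ ≥ 0`), then every absolute row and
column sum of `gram120 τ q` is `≤ τ·C_col·R_row` (`gram120_rowsum_le`, `gram120_colsum_le`; `gram120_symm`).  For
Bałaban's `Q_k` on `T_η` (`η = L^{−k} = 1/n`): `τ = n^d`, `R_row = 1` (each row of `q` is a probability vector),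
`C_col = n^{−d}` (every fine bond lies on exactly `n` of the averaging segments, each of weight `η^{d+1}`), `r ≤ 2n` fine
steps — so `Q*Q` has range `≤ 4n` and Schur bound `1`, and the local bound of §2 for `aQ*Q` is
`(4d/(M₀n))·4n·|a| = 16d|a|/M₀` in fine units (`M₀′ = M₀ n`), UNIFORMLY in `η` — the printed `O(M₀⁻¹)`.
§4 (1.128) WITH THE LOCAL HYPOTHESIS DISCHARGED: `h128_finiteRange_torus` = `B5Leibniz121.h128_lap_torus` with
`local′` supplied by §2 (`ℓ′ := (4d/M₀)ρR`), for `Δ_model = kerOp (lapKer w + l′) + kerOp k` with `l′` ANY finite-range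
kernel (range `ρ ≥ 1`, Schur bound `R`) — constant
`((4d/M₀)√(2d) + 52d/M₀² + (4d/M₀)ρR)·e^{4+ρ/M₀} + (4d/M₀)·C·(24/(eδ))·m·K_d(δ/8)·e⁷`; and `h128_gram_torus`, the case
`l′ = a·gram120 τ q` (`ρ = 2r`, `R = |a|τC_colR_row`).  After this file the ONLY analytic hypothesis of the torus-model
(1.128) leaf is the decay (1.126) of `k` (B4 territory: «Lemma 2.4 of [2]» + analyticity; cell GAPS G-B5-31 (b)),
besides the structural data (`w` an axis Laplacian with fibres `≤ m`; `q` of bounded support and absolute row/column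
sums).  `Kop_neg`/`norm_Kop_neg`: the bound is insensitive to the overall sign of `Δ_model` (Bałaban's `Δ = Σ_μ ∂_μ*∂_μ`
is `−Δ_w` in the sign convention of `lapKer`).

DIVERGENCES (cell DIVERGENCE.md, D-b05g6.1).  (i) `Q`, `Q*`, `S(∂h)`, `S*(∂h)`, `P₁(∂h)` are typed as ABSTRACT kernel
operators between finite component spaces (`rectOp`), with the support / row-sum / column-sum properties of Bałaban's
`Q_k` as HYPOTHESES of §3–§4; the concrete kernel `q(y; x₁, μ) = η^{d+1}·#{x ∈ B^k(y) : x₁ ∈ [x, x^{(k)}[}` on the fine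
torus is described in the docstrings but NOT constructed in this file (no operator calculus of B5 §1 exists in the
tree; cf. G-B5-31 (c)).  (ii) The weighted adjoint is `τ·(transpose)`; the identification `τ = η^{−d}` with the printed
pairings `⟨·,·⟩` of (1.120) is the dictionary of `rectAdj_adjoint`, not a typed statement about `T_η`.  (iii) `hc` (the
multiplier on coarse components) is arbitrary in §1; in print it is `h` restricted to `T₁^{(k)} ⊂ T_η`.  (iv) As in
`B5Leibniz121`: sup circular distance on the torus, `2M₀ ≤ N_i`, constants unoptimised; the consumer's gradient norm
enters only through `√(dirichlet w A) ≤ ‖Dg A‖` (the `Q`-terms need no gradient at all).  (v) `P₁(∂h)` is typed and its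
identity checked, but its SIZE is the decaying-kernel part of `B5Commutator128` ((1.126) ⟹ `O(M₀⁻¹)` there), not §2.

HONEST LABELLING.  Nothing here is a claim of the paper beyond the displays quoted; every statement is kernel-proved;
decls marked MODEL are this library's; [folklore] marks elementary facts.  Imports: `B5Leibniz121` (hence
`B5Commutator128`, `B5SmoothPartition`, `B5TorusCover`) and Mathlib.
value = kernel certificate of a located leaf (the first-order local terms of (1.121) ⟹ the hypothesis `local′` of the
(1.128) leaf with `ℓ′ = O(M₀⁻¹)`, uniformly in the torus; (1.120)/(1.121) as operator algebra) — NOT summit progress.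
-/
import Mathlib
import Literature.MathematicalPhysics.QuantumFieldTheory.Balaban1983to89.B5Leibniz121

open Finset

namespace Literature.MathematicalPhysics.QuantumFieldTheory.Balaban1983to89.B5Averaging120

open B5TorusPartition (mulOp mulOp_apply norm_mulOp_le)
open B5Commutator128 (kerOp kerOp_apply kerOp_add kerOp_sub comm_mulOp_kerOp norm_kerOp_le mulOp_mul_kerOp
  kerOp_mul_mulOp)
open B5TorusCover (UT Ctr ctrU)
open B5SmoothPartition (hSU HSop hSU_lipschitz)
open B5Leibniz121 (lapKer dirichlet IsAxisLap h128_lap_torus)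
open B5Local114 (Kop)
open B5Walk131 (twoDelta0)

noncomputable section

/-! ## §1  Rectangular kernel operators, the weighted adjoint, the Gram kernel; the objects and identities of (1.120)
and the operator identity (1.121) -/

section Rect

variable {ι κ ε : Type} [Fintype ι] [Fintype κ] [Fintype ε]

/-- MODEL. The rectangular kernel operator `ℓ²(ι) → ℓ²(κ)` with kernel `q : κ → ι → ℝ`:
`(rectOp q v) c = Σ_i q c i · v i` — the shape of the averaging operator `Q` of (1.11)/(1.120) between the component
spaces of the fine and the coarse lattice. [cite: Balaban1984PropagatorsI, (1.11) p.19, (1.120) p.37] -/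
def rectOp (q : κ → ι → ℝ) : EuclideanSpace ℝ ι →ₗ[ℝ] EuclideanSpace ℝ κ where
  toFun v := WithLp.toLp 2 fun c => ∑ i, q c i * v i
  map_add' u v := by
    ext c
    simp only [PiLp.add_apply, mul_add, Finset.sum_add_distrib]
  map_smul' r v := by
    ext c
    simp only [PiLp.smul_apply, smul_eq_mul, RingHom.id_apply, Finset.mul_sum]
    exact Finset.sum_congr rfl fun j _ => by ring

omit [Fintype κ] in
/-- `(rectOp q v) c = Σ_i q c i · v i`. [folklore] -/
@[simp] theorem rectOp_apply (q : κ → ι → ℝ) (v : EuclideanSpace ℝ ι) (c : κ) :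
    rectOp q v c = ∑ i, q c i * v i := rfl

/-- A square rectangular kernel operator is the kernel operator of `B5Commutator128`. [folklore] -/
theorem rectOp_eq_kerOp (k : ι → ι → ℝ) : rectOp k = kerOp k := rfl

omit [Fintype ε] in
/-- Composition of rectangular kernel operators is the rectangular kernel operator of the product kernel.
[folklore] -/
theorem rectOp_comp (p : ε → κ → ℝ) (q : κ → ι → ℝ) :
    rectOp p ∘ₗ rectOp q = rectOp fun e i => ∑ c, p e c * q c i := by
  apply LinearMap.ext
  intro v
  ext e
  simp only [LinearMap.coe_comp, Function.comp_apply, rectOp_apply, Finset.mul_sum, Finset.sum_mul]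
  rw [Finset.sum_comm]
  exact Finset.sum_congr rfl fun c _ => Finset.sum_congr rfl fun i _ => by ring

omit [Fintype κ] in
/-- `rectOp q` after a multiplier rescales the columns of `q`. [folklore] -/
theorem rectOp_comp_mulOp (q : κ → ι → ℝ) (h : ι → ℝ) :
    rectOp q ∘ₗ mulOp h = rectOp fun c i => q c i * h i := by
  apply LinearMap.ext
  intro v
  ext c
  simp only [LinearMap.coe_comp, Function.comp_apply, rectOp_apply, mulOp_apply, mul_assoc]

omit [Fintype κ] in
/-- A multiplier after `rectOp q` rescales the rows of `q`. [folklore] -/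
theorem mulOp_comp_rectOp (q : κ → ι → ℝ) (hc : κ → ℝ) :
    mulOp hc ∘ₗ rectOp q = rectOp fun c i => hc c * q c i := by
  apply LinearMap.ext
  intro v
  ext c
  simp only [LinearMap.coe_comp, Function.comp_apply, rectOp_apply, mulOp_apply, Finset.mul_sum, mul_assoc]

omit [Fintype κ] in
/-- `rectOp` is additive in the kernel. [folklore] -/
theorem rectOp_add (p q : κ → ι → ℝ) : rectOp (fun c i => p c i + q c i) = rectOp p + rectOp q := by
  apply LinearMap.ext
  intro v
  ext c
  simp only [rectOp_apply, LinearMap.add_apply, PiLp.add_apply, add_mul, Finset.sum_add_distrib]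

omit [Fintype κ] in
/-- `rectOp` is subtractive in the kernel. [folklore] -/
theorem rectOp_sub (p q : κ → ι → ℝ) : rectOp (fun c i => p c i - q c i) = rectOp p - rectOp q := by
  apply LinearMap.ext
  intro v
  ext c
  simp only [rectOp_apply, LinearMap.sub_apply, PiLp.sub_apply, sub_mul, Finset.sum_sub_distrib]

/-- MODEL. The WEIGHTED ADJOINT `Q*` of `Q = rectOp q`: the transpose kernel scaled by the ratio `τ` of the weights of
the two `ℓ²` pairings (`τ = η^{−d}` when the fine side carries `⟨f, g⟩ = Σ η^d f g` and the coarse side the plain sum,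
as for `Q_k : T_η → T₁^{(k)}`; see `rectAdj_adjoint`). [cite: Balaban1984PropagatorsI, (1.120) p.37 (the operator Q*)] -/
def rectAdj (τ : ℝ) (q : κ → ι → ℝ) : EuclideanSpace ℝ κ →ₗ[ℝ] EuclideanSpace ℝ ι :=
  rectOp fun i c => τ * q c i

omit [Fintype ι] in
/-- `(rectAdj τ q w) i = Σ_c τ q c i · w c`. [folklore] -/
@[simp] theorem rectAdj_apply (τ : ℝ) (q : κ → ι → ℝ) (w : EuclideanSpace ℝ κ) (i : ι) :
    rectAdj τ q w i = ∑ c, τ * q c i * w c := rfl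

/-- **The adjunction**: if `στ = 1` then `σ·Σ_i v_i (Q*w)_i = Σ_c (Qv)_c w_c` — `rectAdj τ q` is the adjoint of
`rectOp q` for the pairing with weight `σ` on the fine side against the plain pairing on the coarse side (in print
`⟨A, Q*ω⟩ = ⟨QA, ω⟩`). [cite: Balaban1984PropagatorsI, (1.120) p.37, the line ⟨A_μ, Q*hω_μ⟩ = ⟨hQA_μ, ω_μ⟩] -/
theorem rectAdj_adjoint {σ τ : ℝ} (hστ : σ * τ = 1) (q : κ → ι → ℝ) (v : EuclideanSpace ℝ ι)
    (w : EuclideanSpace ℝ κ) :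
    σ * ∑ i, v i * rectAdj τ q w i = ∑ c, rectOp q v c * w c := by
  simp only [rectAdj_apply, rectOp_apply, Finset.mul_sum, Finset.sum_mul]
  rw [Finset.sum_comm]
  refine Finset.sum_congr rfl fun c _ => Finset.sum_congr rfl fun i _ => ?_
  calc σ * (v i * (τ * q c i * w c)) = σ * τ * (q c i * v i * w c) := by ring
    _ = q c i * v i * w c := by rw [hστ, one_mul]

/-- MODEL. The GRAM KERNEL of `Q*Q`: `gram120 τ q i j = Σ_c τ q c i q c j`. [cite: Balaban1984PropagatorsI, (1.121) p.37 (the term aQ*Q of Δ_a)] -/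
def gram120 (τ : ℝ) (q : κ → ι → ℝ) (i j : ι) : ℝ := ∑ c, τ * q c i * q c j

/-- **`Q*Q` is the square kernel operator of the Gram kernel.** [folklore] -/
theorem rectAdj_comp_rectOp (τ : ℝ) (q : κ → ι → ℝ) :
    rectAdj τ q ∘ₗ rectOp q = kerOp (gram120 τ q) := by
  unfold rectAdj
  rw [rectOp_comp]
  rfl

omit [Fintype ι] in
/-- The Gram kernel is symmetric. [folklore] -/
theorem gram120_symm (τ : ℝ) (q : κ → ι → ℝ) (i j : ι) : gram120 τ q i j = gram120 τ q j i :=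
  Finset.sum_congr rfl fun c _ => by ring

/-- MODEL. **`S(∂h)` of (1.120)**: the rectangular kernel operator with kernel `q c i · (h i − hc c)` — the printed
`Σ_{x∈B^k(y)} η^d Σ_{x₁∈[x,x^{(k)}[} η(∂h)(Γ_{y,x} ∪ [x, x₁])A_μ(x₁)` with the contour sum telescoped,
`(∂h)(Γ_{y,x} ∪ [x, x₁]) = h(x₁) − h(y)`; `hc` is the multiplier on the coarse components (in print `h(y)`,
`y ∈ T₁^{(k)} ⊂ T_η`). [cite: Balaban1984PropagatorsI, (1.120) p.37, line 2] -/
def sComm120 (q : κ → ι → ℝ) (h : ι → ℝ) (hc : κ → ℝ) : EuclideanSpace ℝ ι →ₗ[ℝ] EuclideanSpace ℝ κ :=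
  rectOp fun c i => q c i * (h i - hc c)

/-- MODEL. **`S*(∂h)` of (1.120)**: the weighted adjoint of `S(∂h)`. [cite: Balaban1984PropagatorsI, (1.120) p.37, line 3] -/
def sAdj120 (τ : ℝ) (q : κ → ι → ℝ) (h : ι → ℝ) (hc : κ → ℝ) :
    EuclideanSpace ℝ κ →ₗ[ℝ] EuclideanSpace ℝ ι :=
  rectOp fun i c => τ * (q c i * (h i - hc c))

omit [Fintype ι] in
/-- `S*(∂h)` is the weighted adjoint of `S(∂h)` (same weight ratio as `Q*`). [folklore] -/
theorem sAdj120_eq (τ : ℝ) (q : κ → ι → ℝ) (h : ι → ℝ) (hc : κ → ℝ) :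
    sAdj120 τ q h hc = rectAdj τ fun c i => q c i * (h i - hc c) := rfl

/-- MODEL. **`P₁(∂h)` of (1.120)**: the kernel operator with kernel `(h i − h j)·k i j` for the kernel `k` of `∂P∂*` —
the printed `Σ_{x′,ν} η^d (∂h)(Γ_{x,x′})(∂P∂*)_{μν}(x, x′)A_ν(x′)` with `(∂h)(Γ_{x,x′}) = h(x) − h(x′)` (the reading
forced by the last line of (1.120); cell GAPS G-adv4-21 (i)). [cite: Balaban1984PropagatorsI, (1.120) p.37, line 4] -/
def p1Comm120 (k : ι → ι → ℝ) (h : ι → ℝ) : Module.End ℝ (EuclideanSpace ℝ ι) :=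
  kerOp fun i j => (h i - h j) * k i j

/-- `P₁(∂h) = h∘(∂P∂*) − (∂P∂*)∘h` (the commutator identity of `B5Commutator128`). [folklore] -/
theorem p1Comm120_eq (k : ι → ι → ℝ) (h : ι → ℝ) :
    p1Comm120 k h = mulOp h * kerOp k - kerOp k * mulOp h := by
  unfold p1Comm120
  rw [comm_mulOp_kerOp]

omit [Fintype κ] in
/-- **(1.120), line 2: `Q∘h = h_c∘Q + S(∂h)`** (`(QhA)(y) = h(y)(QA)(y) + (S(∂h)A)(y)`), for every kernel `q` and all
multipliers `h` (fine) and `hc` (coarse). [cite: Balaban1984PropagatorsI, (1.120) p.37, line 2] -/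
theorem rectOp_mulOp (q : κ → ι → ℝ) (h : ι → ℝ) (hc : κ → ℝ) :
    rectOp q ∘ₗ mulOp h = mulOp hc ∘ₗ rectOp q + sComm120 q h hc := by
  unfold sComm120
  rw [rectOp_comp_mulOp, mulOp_comp_rectOp, ← rectOp_add]
  congr 1
  funext c i
  ring

omit [Fintype ι] in
/-- **(1.120), line 3 (first half): `Q*∘h_c = h∘Q* − S*(∂h)`** (`Q*hω = hQ*ω − S*(∂h)ω`).
[cite: Balaban1984PropagatorsI, (1.120) p.37, line 3] -/
theorem rectAdj_mulOp (τ : ℝ) (q : κ → ι → ℝ) (h : ι → ℝ) (hc : κ → ℝ) :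
    rectAdj τ q ∘ₗ mulOp hc = mulOp h ∘ₗ rectAdj τ q - sAdj120 τ q h hc := by
  unfold rectAdj sAdj120
  rw [rectOp_comp_mulOp, mulOp_comp_rectOp, ← rectOp_sub]
  congr 1
  funext i c
  ring

/-- **(1.120), line 3 (second half): `Q*Q∘h = h∘Q*Q − S*(∂h)Q + Q*S(∂h)`**
(`Q*QhA = Q*hQA + Q*S(∂h)A = hQ*QA − S*(∂h)QA + Q*S(∂h)A`). [cite: Balaban1984PropagatorsI, (1.120) p.37, line 3] -/
theorem gram_mulOp (τ : ℝ) (q : κ → ι → ℝ) (h : ι → ℝ) (hc : κ → ℝ) :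
    (rectAdj τ q ∘ₗ rectOp q) ∘ₗ mulOp h
      = mulOp h ∘ₗ (rectAdj τ q ∘ₗ rectOp q) - sAdj120 τ q h hc ∘ₗ rectOp q
        + rectAdj τ q ∘ₗ sComm120 q h hc := by
  calc (rectAdj τ q ∘ₗ rectOp q) ∘ₗ mulOp h
      = rectAdj τ q ∘ₗ (rectOp q ∘ₗ mulOp h) := by rw [LinearMap.comp_assoc]
    _ = rectAdj τ q ∘ₗ (mulOp hc ∘ₗ rectOp q + sComm120 q h hc) := by rw [rectOp_mulOp q h hc]
    _ = (rectAdj τ q ∘ₗ mulOp hc) ∘ₗ rectOp q + rectAdj τ q ∘ₗ sComm120 q h hc := by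
        rw [LinearMap.comp_add, LinearMap.comp_assoc]
    _ = (mulOp h ∘ₗ rectAdj τ q - sAdj120 τ q h hc) ∘ₗ rectOp q + rectAdj τ q ∘ₗ sComm120 q h hc := by
        rw [rectAdj_mulOp τ q h hc]
    _ = _ := by rw [LinearMap.sub_comp, LinearMap.comp_assoc]

/-- **(1.120), line 4: `∂P∂*∘h = h∘∂P∂* − P₁(∂h)`** (`(∂P∂*hA)(x) = h(x)(∂P∂*A)(x) − (P₁(∂h)A)(x)`), for every
square kernel `k`. [cite: Balaban1984PropagatorsI, (1.120) p.37, line 4] -/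
theorem kerOp_mulOp_eq (k : ι → ι → ℝ) (h : ι → ℝ) :
    kerOp k * mulOp h = mulOp h * kerOp k - p1Comm120 k h := by
  rw [p1Comm120_eq, sub_sub_cancel]

/-- **(1.121) AS AN OPERATOR IDENTITY.**  For `Δ_a := L − kerOp k + a•Q*Q` (`L` standing for `Δ`, `kerOp k` for
`∂P∂*`, `Q*Q = rectAdj τ q ∘ rectOp q`):
`hΔ_a − Δ_a h = (hL − Lh) − P₁(∂h) + a·(S*(∂h)Q − Q*S(∂h))`.
With `B5Leibniz121.comm_lap_apply` for `hL − Lh` this is `K(h)` of (1.121); REMARK: the bracket of (1.121) as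
printed carries `+P₁(∂h)A` and no factor `a` on the `S`-terms — with the objects of (1.120) the identity forces
`−P₁(∂h)A` and `+aS*(∂h)QA − aQ*S(∂h)A` (cell GAPS G-adv4-21 (i)–(ii); print level, only `|·|` is used downstream).
[cite: Balaban1984PropagatorsI, (1.121) p.37] -/
theorem K121_eq (L : Module.End ℝ (EuclideanSpace ℝ ι)) (k : ι → ι → ℝ) (a τ : ℝ) (q : κ → ι → ℝ)
    (h : ι → ℝ) (hc : κ → ℝ) :
    mulOp h * (L - kerOp k + a • (rectAdj τ q ∘ₗ rectOp q))
        - (L - kerOp k + a • (rectAdj τ q ∘ₗ rectOp q)) * mulOp h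
      = (mulOp h * L - L * mulOp h) - p1Comm120 k h
        + a • (sAdj120 τ q h hc ∘ₗ rectOp q - rectAdj τ q ∘ₗ sComm120 q h hc) := by
  have e3 : (rectAdj τ q ∘ₗ rectOp q) * mulOp h
      = mulOp h * (rectAdj τ q ∘ₗ rectOp q) - sAdj120 τ q h hc ∘ₗ rectOp q
        + rectAdj τ q ∘ₗ sComm120 q h hc := by
    rw [Module.End.mul_eq_comp, Module.End.mul_eq_comp]
    exact gram_mulOp τ q h hc
  have e4 := kerOp_mulOp_eq k h
  rw [mul_add, mul_sub, add_mul, sub_mul, mul_smul_comm, smul_mul_assoc, e3, e4, smul_add, smul_sub, smul_sub]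
  abel

/-- The same identity for the commutator family `Kop` of `B5Local114` (`Kop Δa H z = H z * Δa − Δa * H z`) with
`H z = mulOp (h z)`: `K(h_z)` of (1.121)–(1.122) for the model `Δ_a`. [cite: Balaban1984PropagatorsI, (1.121)–(1.122) p.37] -/
theorem Kop_K121_eq {S : Type} (L : Module.End ℝ (EuclideanSpace ℝ ι)) (k : ι → ι → ℝ) (a τ : ℝ)
    (q : κ → ι → ℝ) (h : S → ι → ℝ) (hc : S → κ → ℝ) (z : S) :
    Kop (L - kerOp k + a • (rectAdj τ q ∘ₗ rectOp q)) (fun z => mulOp (h z)) z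
      = (mulOp (h z) * L - L * mulOp (h z)) - p1Comm120 k (h z)
        + a • (sAdj120 τ q (h z) (hc z) ∘ₗ rectOp q - rectAdj τ q ∘ₗ sComm120 q (h z) (hc z)) := by
  unfold Kop
  exact K121_eq L k a τ q (h z) (hc z)

/-- `Kop` is odd in the operator: `Kop (−Δ) H z = −Kop Δ H z`. [folklore] -/
theorem Kop_neg {V : Type} [AddCommGroup V] [Module ℝ V] {S : Type} (Δ : Module.End ℝ V)
    (H : S → Module.End ℝ V) (z : S) : Kop (-Δ) H z = -Kop Δ H z := by
  simp only [Kop, mul_neg, neg_mul]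
  abel

/-- The paired commutator norm `‖H z₁ (Kop Δ H z₂ A)‖` of (1.128) is insensitive to the sign of `Δ` (Bałaban's
`Δ = Σ_μ ∂_μ*∂_μ ≥ 0` is `−Δ_w` in the sign convention of `B5Leibniz121.lapKer`). [folklore] -/
theorem norm_Kop_neg {V : Type} [NormedAddCommGroup V] [NormedSpace ℝ V] {S : Type} (Δ : Module.End ℝ V)
    (H : S → Module.End ℝ V) (z₁ z₂ : S) (A : V) :
    ‖H z₁ (Kop (-Δ) H z₂ A)‖ = ‖H z₁ (Kop Δ H z₂ A)‖ := by
  rw [Kop_neg, LinearMap.neg_apply, map_neg, norm_neg]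

end Rect

/-! ## §2  The first-order local bound: commutator of a Lipschitz multiplier with a finite-range kernel -/

section FiniteRange

variable {ι : Type} [Fintype ι] {X : Type} [PseudoMetricSpace X]

omit [Fintype ι] in
/-- Entries of the commutator kernel: `|(a_i − a_j) m_ij| ≤ ℓρ|m_ij|` for a `ℓ`-Lipschitz multiplier and a kernel
vanishing beyond distance `ρ`. [folklore] -/
theorem abs_comm_entry_le (π : ι → X) {a : ι → ℝ} {m : ι → ι → ℝ} {ℓ ρ : ℝ} (hℓ : 0 ≤ ℓ)
    (lip : ∀ i j, |a i - a j| ≤ ℓ * dist (π i) (π j)) (range : ∀ i j, ρ < dist (π i) (π j) → m i j = 0)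
    (i j : ι) : |(a i - a j) * m i j| ≤ ℓ * ρ * |m i j| := by
  rw [abs_mul]
  by_cases hfar : ρ < dist (π i) (π j)
  · rw [range i j hfar, abs_zero, mul_zero, mul_zero]
  · have hle : dist (π i) (π j) ≤ ρ := not_lt.mp hfar
    calc |a i - a j| * |m i j| ≤ ℓ * dist (π i) (π j) * |m i j| :=
          mul_le_mul_of_nonneg_right (lip i j) (abs_nonneg _)
      _ ≤ ℓ * ρ * |m i j| :=
          mul_le_mul_of_nonneg_right (mul_le_mul_of_nonneg_left hle hℓ) (abs_nonneg _)

/-- **THE FIRST-ORDER LOCAL BOUND.**  If `|a_i − a_j| ≤ ℓ·dist(π i, π j)`, `m_ij = 0` for `dist(π i, π j) > ρ`, and all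
absolute row and column sums of `m` are `≤ R`, then `‖[mulOp a, kerOp m] v‖ ≤ ℓρR‖v‖` — «a simple, shortranged,
first order» operator with coefficients `O(ℓ)`. [cite: Balaban1984PropagatorsI, p.38 (the sentence before (1.126)) with (1.121) p.37] -/
theorem norm_comm_finiteRange_le (π : ι → X) {a : ι → ℝ} {m : ι → ι → ℝ} {ℓ ρ R : ℝ} (hℓ : 0 ≤ ℓ)
    (hρ : 0 ≤ ρ) (lip : ∀ i j, |a i - a j| ≤ ℓ * dist (π i) (π j))
    (range : ∀ i j, ρ < dist (π i) (π j) → m i j = 0) (hR : ∀ i, ∑ j, |m i j| ≤ R)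
    (hC : ∀ j, ∑ i, |m i j| ≤ R) (v : EuclideanSpace ℝ ι) :
    ‖(mulOp a * kerOp m - kerOp m * mulOp a) v‖ ≤ ℓ * ρ * R * ‖v‖ := by
  rw [comm_mulOp_kerOp]
  have hent := abs_comm_entry_le π hℓ lip range
  have hℓρ : 0 ≤ ℓ * ρ := mul_nonneg hℓ hρ
  have hR' : ∀ i, ∑ j, |(a i - a j) * m i j| ≤ ℓ * ρ * R := fun i =>
    calc ∑ j, |(a i - a j) * m i j| ≤ ∑ j, ℓ * ρ * |m i j| := Finset.sum_le_sum fun j _ => hent i j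
      _ = ℓ * ρ * ∑ j, |m i j| := by rw [Finset.mul_sum]
      _ ≤ ℓ * ρ * R := mul_le_mul_of_nonneg_left (hR i) hℓρ
  have hC' : ∀ j, ∑ i, |(a i - a j) * m i j| ≤ ℓ * ρ * R := fun j =>
    calc ∑ i, |(a i - a j) * m i j| ≤ ∑ i, ℓ * ρ * |m i j| := Finset.sum_le_sum fun i _ => hent i j
      _ = ℓ * ρ * ∑ i, |m i j| := by rw [Finset.mul_sum]
      _ ≤ ℓ * ρ * R := mul_le_mul_of_nonneg_left (hC j) hℓρ
  exact norm_kerOp_le hR' hC' v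

variable {d : ℕ} {N : Fin d → ℕ} [∀ i, NeZero (N i)]

/-- **The local bound on the torus with the smooth partition**: `‖[hS_z, kerOp m]A‖ ≤ (4d/M₀)·ρ·R·‖A‖` for every
finite-range kernel `m` (range `ρ`, absolute row/column sums `≤ R`) — only the Lipschitz datum `∇h_z = O(M₀⁻¹)`
(`hSU_lipschitz`) is consumed. [cite: Balaban1984PropagatorsI, (1.128) p.38 with (1.121) p.37 (the terms S*(∂h)QA − Q*S(∂h)A)] -/
theorem local_finiteRange_HS {M₀ : ℕ} (hM : 1 ≤ M₀) (π : ι → UT N) (z : Ctr N M₀) {m : ι → ι → ℝ}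
    {ρ R : ℝ} (hρ : 0 ≤ ρ) (range : ∀ i j, ρ < dist (π i) (π j) → m i j = 0)
    (hR : ∀ i, ∑ j, |m i j| ≤ R) (hC : ∀ j, ∑ i, |m i j| ≤ R) (A : EuclideanSpace ℝ ι) :
    ‖(HSop N M₀ π z * kerOp m - kerOp m * HSop N M₀ π z) A‖ ≤ 4 * d / M₀ * ρ * R * ‖A‖ := by
  unfold HSop
  exact norm_comm_finiteRange_le π (by positivity) hρ (fun i j => hSU_lipschitz N hM z (π i) (π j))
    range hR hC A

/-- The same bound in the shape of the hypothesis `local′` of `B5Leibniz121.h128_lap_torus` (any `Dg`; the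
finite-range terms need no gradient). [cite: Balaban1984PropagatorsI, (1.128) p.38] -/
theorem local_finiteRange_HS' {M₀ : ℕ} (hM : 1 ≤ M₀) (π : ι → UT N) {m : ι → ι → ℝ} {ρ R : ℝ}
    (hρ : 0 ≤ ρ) (hR0 : 0 ≤ R) (range : ∀ i j, ρ < dist (π i) (π j) → m i j = 0)
    (hR : ∀ i, ∑ j, |m i j| ≤ R) (hC : ∀ j, ∑ i, |m i j| ≤ R)
    (Dg : Module.End ℝ (EuclideanSpace ℝ ι)) (z : Ctr N M₀) (A : EuclideanSpace ℝ ι) :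
    ‖(HSop N M₀ π z * kerOp m - kerOp m * HSop N M₀ π z) A‖
      ≤ 4 * d / M₀ * ρ * R * (‖Dg A‖ + ‖A‖) := by
  have h := local_finiteRange_HS hM π z hρ range hR hC A
  have h0 : (0 : ℝ) ≤ 4 * d / M₀ * ρ * R := by positivity
  have h1 : ‖A‖ ≤ ‖Dg A‖ + ‖A‖ := le_add_of_nonneg_left (norm_nonneg _)
  exact h.trans (mul_le_mul_of_nonneg_left h1 h0)

end FiniteRange

/-! ## §3  Support and Schur data of the Gram kernel `Q*Q` from those of `Q` -/

section Gram

variable {ι κ : Type} [Fintype ι] [Fintype κ] {X : Type} [PseudoMetricSpace X]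

omit [Fintype ι] in
/-- **Range of `Q*Q`**: if `q c i ≠ 0 ⇒ dist(σ c, π i) ≤ r` (the averaging kernel sees only fine components within
`r` of the coarse one), then `gram120 τ q i j = 0` whenever `dist(π i, π j) > 2r`. [folklore] -/
theorem gram120_eq_zero_of_far (σ : κ → X) (π : ι → X) {q : κ → ι → ℝ} {r : ℝ} (τ : ℝ)
    (supp : ∀ c i, q c i ≠ 0 → dist (σ c) (π i) ≤ r) {i j : ι} (hfar : 2 * r < dist (π i) (π j)) :
    gram120 τ q i j = 0 := by
  apply Finset.sum_eq_zero
  intro c _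
  by_cases hi : q c i = 0
  · rw [hi, mul_zero, zero_mul]
  by_cases hj : q c j = 0
  · rw [hj, mul_zero]
  exfalso
  have h1 := supp c i hi
  have h2 := supp c j hj
  have h3 : dist (π i) (π j) ≤ dist (σ c) (π i) + dist (σ c) (π j) := by
    rw [dist_comm (σ c) (π i)]
    exact dist_triangle _ _ _
  linarith

/-- **Row sums of `Q*Q`**: absolute column sums of `q` `≤ C_col` and absolute row sums `≤ R_row` (`τ ≥ 0`,
`R_row ≥ 0`) give `Σ_j |gram120 τ q i j| ≤ τ·C_col·R_row`. [folklore] -/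
theorem gram120_rowsum_le {q : κ → ι → ℝ} {τ Ccol Rrow : ℝ} (hτ : 0 ≤ τ) (hRrow : 0 ≤ Rrow)
    (col : ∀ i, ∑ c, |q c i| ≤ Ccol) (row : ∀ c, ∑ j, |q c j| ≤ Rrow) (i : ι) :
    ∑ j, |gram120 τ q i j| ≤ τ * Ccol * Rrow := by
  calc ∑ j, |gram120 τ q i j| ≤ ∑ j, ∑ c, τ * |q c i| * |q c j| := by
        refine Finset.sum_le_sum fun j _ => (Finset.abs_sum_le_sum_abs _ _).trans (le_of_eq ?_)
        exact Finset.sum_congr rfl fun c _ => by rw [abs_mul, abs_mul, abs_of_nonneg hτ]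
    _ = ∑ c, τ * |q c i| * ∑ j, |q c j| := by
        rw [Finset.sum_comm]
        exact Finset.sum_congr rfl fun c _ => by rw [Finset.mul_sum]
    _ ≤ ∑ c, τ * |q c i| * Rrow :=
        Finset.sum_le_sum fun c _ => mul_le_mul_of_nonneg_left (row c) (by positivity)
    _ = τ * Rrow * ∑ c, |q c i| := by rw [Finset.mul_sum]; exact Finset.sum_congr rfl fun c _ => by ring
    _ ≤ τ * Rrow * Ccol := mul_le_mul_of_nonneg_left (col i) (by positivity)
    _ = τ * Ccol * Rrow := by ring

/-- **Column sums of `Q*Q`** (by symmetry of the Gram kernel). [folklore] -/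
theorem gram120_colsum_le {q : κ → ι → ℝ} {τ Ccol Rrow : ℝ} (hτ : 0 ≤ τ) (hRrow : 0 ≤ Rrow)
    (col : ∀ i, ∑ c, |q c i| ≤ Ccol) (row : ∀ c, ∑ j, |q c j| ≤ Rrow) (j : ι) :
    ∑ i, |gram120 τ q i j| ≤ τ * Ccol * Rrow := by
  calc ∑ i, |gram120 τ q i j| = ∑ i, |gram120 τ q j i| :=
        Finset.sum_congr rfl fun i _ => by rw [gram120_symm]
    _ ≤ τ * Ccol * Rrow := gram120_rowsum_le hτ hRrow col row j

/-- The kernel of `a•Q*Q` has absolute row sums `≤ |a|·τ·C_col·R_row`. [folklore] -/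
theorem smul_gram120_rowsum_le {q : κ → ι → ℝ} {τ Ccol Rrow : ℝ} (a : ℝ) (hτ : 0 ≤ τ) (hRrow : 0 ≤ Rrow)
    (col : ∀ i, ∑ c, |q c i| ≤ Ccol) (row : ∀ c, ∑ j, |q c j| ≤ Rrow) (i : ι) :
    ∑ j, |a * gram120 τ q i j| ≤ |a| * (τ * Ccol * Rrow) := by
  calc ∑ j, |a * gram120 τ q i j| = |a| * ∑ j, |gram120 τ q i j| := by
        rw [Finset.mul_sum]; exact Finset.sum_congr rfl fun j _ => abs_mul _ _
    _ ≤ |a| * (τ * Ccol * Rrow) := mul_le_mul_of_nonneg_left (gram120_rowsum_le hτ hRrow col row i) (abs_nonneg a)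

/-- The kernel of `a•Q*Q` has absolute column sums `≤ |a|·τ·C_col·R_row`. [folklore] -/
theorem smul_gram120_colsum_le {q : κ → ι → ℝ} {τ Ccol Rrow : ℝ} (a : ℝ) (hτ : 0 ≤ τ) (hRrow : 0 ≤ Rrow)
    (col : ∀ i, ∑ c, |q c i| ≤ Ccol) (row : ∀ c, ∑ j, |q c j| ≤ Rrow) (j : ι) :
    ∑ i, |a * gram120 τ q i j| ≤ |a| * (τ * Ccol * Rrow) := by
  calc ∑ i, |a * gram120 τ q i j| = |a| * ∑ i, |gram120 τ q i j| := by
        rw [Finset.mul_sum]; exact Finset.sum_congr rfl fun i _ => abs_mul _ _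
    _ ≤ |a| * (τ * Ccol * Rrow) := mul_le_mul_of_nonneg_left (gram120_colsum_le hτ hRrow col row j) (abs_nonneg a)

/-- `a•Q*Q = kerOp (a·gram120 τ q)` as operators on the fine components. [folklore] -/
theorem smul_gram_eq_kerOp (a τ : ℝ) (q : κ → ι → ℝ) :
    a • (rectAdj τ q ∘ₗ rectOp q) = kerOp fun i j => a * gram120 τ q i j := by
  rw [rectAdj_comp_rectOp]
  apply LinearMap.ext
  intro v
  ext i
  simp only [LinearMap.smul_apply, PiLp.smul_apply, kerOp_apply, smul_eq_mul, Finset.mul_sum, mul_assoc]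

end Gram

/-! ## §4  (1.128) for `Δ_model = Δ_w + (finite-range kernel) + (decaying kernel)` with the local hypothesis
DISCHARGED; the case `aQ*Q` -/

section Assembly

variable {d : ℕ} {N : Fin d → ℕ} [∀ i, NeZero (N i)] {ι : Type} [Fintype ι] [DecidableEq ι]

/-- **(1.128) FOR `Δ_model = kerOp (lapKer w + l′) + kerOp k`, THE LOCAL HYPOTHESIS DISCHARGED.**  For an axis
Laplacian `w` through a base map `π` with fibres `≤ m`, ANY finite-range kernel `l′` (range `ρ ≥ 1`, absolute row and
column sums `≤ R`) and a kernel `k` with the decay (1.126) (HYPOTHESIS, B4 territory), the bound (1.128) holds at rate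
`twoDelta0 δ M₀ = min{⅓δ, M₀⁻¹}` with the explicit constant
`((4d/M₀)√(2d) + 52d/M₀² + (4d/M₀)ρR)·e^{4+ρ/M₀} + (4d/M₀)·C·(24/(eδ))·m·K_d(δ/8)·e⁷`, for every torus with
`2M₀ ≤ N_i` and any `Dg` dominating the lattice gradient norm of `w` — `B5Leibniz121.h128_lap_torus` with its
hypothesis `local′` supplied by `local_finiteRange_HS'`. [cite: Balaban1984PropagatorsI, (1.128) p.38 with (1.121) p.37, (1.126) p.38] -/
theorem h128_finiteRange_torus {M₀ : ℕ} (hM : 1 ≤ M₀) (h2N : ∀ i, 2 * M₀ ≤ N i) (π : ι → UT N) {m : ℕ}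
    (hm : ∀ y : UT N, ((Finset.univ.filter fun j : ι => π j = y).card : ℝ) ≤ m)
    {w : ι → ι → ℝ} (hw : IsAxisLap π w) {Dg : Module.End ℝ (EuclideanSpace ℝ ι)}
    (hDg : ∀ A, Real.sqrt (dirichlet w A) ≤ ‖Dg A‖)
    {l' k : ι → ι → ℝ} {ρ R C δ : ℝ} (hρ : 1 ≤ ρ) (range' : ∀ i j, ρ < dist (π i) (π j) → l' i j = 0)
    (hR : ∀ i, ∑ j, |l' i j| ≤ R) (hRc : ∀ j, ∑ i, |l' i j| ≤ R) (hR0 : 0 ≤ R)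
    (decay : ∀ i j, |k i j| ≤ C * Real.exp (-(δ * dist (π i) (π j)))) (hC : 0 ≤ C) (hδ : 0 < δ)
    (z₁ z₂ : Ctr N M₀) (A : EuclideanSpace ℝ ι) :
    ‖HSop N M₀ π z₁ (Kop (kerOp (fun i j => lapKer w i j + l' i j) + kerOp k) (HSop N M₀ π) z₂ A)‖
      ≤ (((4 * d / M₀ * Real.sqrt (2 * d) + 52 * d / (M₀ : ℝ) ^ 2) + 4 * d / M₀ * ρ * R)
            * Real.exp (4 + ρ / M₀)
          + 4 * d / M₀ * C * (24 / (Real.exp 1 * δ)) * (m * B4Sect5Proof.latticeConst d (δ / 8))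
            * Real.exp 7)
        * Real.exp (-(twoDelta0 δ M₀ * dist (ctrU N M₀ z₁) (ctrU N M₀ z₂))) * (‖Dg A‖ + ‖A‖) := by
  have hρ0 : (0 : ℝ) ≤ ρ := by linarith
  have local' : ∀ z A, ‖(HSop N M₀ π z * kerOp l' - kerOp l' * HSop N M₀ π z) A‖
      ≤ 4 * d / M₀ * ρ * R * (‖Dg A‖ + ‖A‖) :=
    fun z A => local_finiteRange_HS' hM π hρ0 hR0 range' hR hRc Dg z A
  exact h128_lap_torus hM h2N π hm hw hDg hρ range' local' (by positivity) decay hC hδ z₁ z₂ A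

variable {κ : Type} [Fintype κ]

/-- **(1.128) FOR `Δ_model = kerOp (lapKer w + a·gram120 τ q) + kerOp k`** — the term `aQ*Q` of
`Δ_a = Δ − ∂P∂* + aQ*Q` as the finite-range part: for an averaging kernel `q` from the fine components (base `π`) to
coarse components (base `σ`) seeing only fine components within `r` of the coarse one (`2r ≥ 1`), with absolute
column sums `≤ C_col` and row sums `≤ R_row`, and weight ratio `τ ≥ 0`, the bound (1.128) holds with `ρ = 2r`,
`R = |a|τC_colR_row` in `h128_finiteRange_torus`.  For Bałaban's `Q_k` (`τ = n^d`, `C_col = n^{−d}`, `R_row = 1`,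
`r ≤ 2n` fine steps — `B5AveragingTorus` takes `r = 2n` —, `M₀′ = M₀n`): the local constant is
`(4d/(M₀n))·4n·|a| = 16d|a|/M₀`, uniformly in `η = 1/n`.
[cite: Balaban1984PropagatorsI, (1.128) p.38 with (1.121) p.37 (the terms S*(∂h)QA − Q*S(∂h)A), (1.126) p.38] -/
theorem h128_gram_torus {M₀ : ℕ} (hM : 1 ≤ M₀) (h2N : ∀ i, 2 * M₀ ≤ N i) (π : ι → UT N) {m : ℕ}
    (hm : ∀ y : UT N, ((Finset.univ.filter fun j : ι => π j = y).card : ℝ) ≤ m)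
    {w : ι → ι → ℝ} (hw : IsAxisLap π w) {Dg : Module.End ℝ (EuclideanSpace ℝ ι)}
    (hDg : ∀ A, Real.sqrt (dirichlet w A) ≤ ‖Dg A‖)
    (σ : κ → UT N) {q : κ → ι → ℝ} {r τ Ccol Rrow : ℝ} (a : ℝ) (hr : 1 ≤ 2 * r) (hτ : 0 ≤ τ)
    (hRrow : 0 ≤ Rrow) (hCcol : 0 ≤ Ccol) (supp : ∀ c i, q c i ≠ 0 → dist (σ c) (π i) ≤ r)
    (col : ∀ i, ∑ c, |q c i| ≤ Ccol) (row : ∀ c, ∑ j, |q c j| ≤ Rrow)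
    {k : ι → ι → ℝ} {C δ : ℝ} (decay : ∀ i j, |k i j| ≤ C * Real.exp (-(δ * dist (π i) (π j))))
    (hC : 0 ≤ C) (hδ : 0 < δ) (z₁ z₂ : Ctr N M₀) (A : EuclideanSpace ℝ ι) :
    ‖HSop N M₀ π z₁ (Kop (kerOp (fun i j => lapKer w i j + a * gram120 τ q i j) + kerOp k)
        (HSop N M₀ π) z₂ A)‖
      ≤ (((4 * d / M₀ * Real.sqrt (2 * d) + 52 * d / (M₀ : ℝ) ^ 2)
              + 4 * d / M₀ * (2 * r) * (|a| * (τ * Ccol * Rrow))) * Real.exp (4 + 2 * r / M₀)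
          + 4 * d / M₀ * C * (24 / (Real.exp 1 * δ)) * (m * B4Sect5Proof.latticeConst d (δ / 8))
            * Real.exp 7)
        * Real.exp (-(twoDelta0 δ M₀ * dist (ctrU N M₀ z₁) (ctrU N M₀ z₂))) * (‖Dg A‖ + ‖A‖) := by
  have range' : ∀ i j, 2 * r < dist (π i) (π j) → a * gram120 τ q i j = 0 := fun i j hij => by
    rw [gram120_eq_zero_of_far σ π τ supp hij, mul_zero]
  exact h128_finiteRange_torus hM h2N π hm hw hDg hr range'
    (smul_gram120_rowsum_le a hτ hRrow col row) (smul_gram120_colsum_le a hτ hRrow col row)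
    (by positivity) decay hC hδ z₁ z₂ A

end Assembly

end

end Literature.MathematicalPhysics.QuantumFieldTheory.Balaban1983to89.B5Averaging120
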